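import Summits.MatrixMultiplication.MatrixMultiplication.Theorems.AbelianSTPPCensusTALin1200Defs

/-!
# T_A/1200 certificate: the candidate enumeration, the state invariant and the loop (soundness, part 1)

Cell mm-stpp (rung F-M1), T_A/1200 = «no abelian STPP host of order `≤ 1200` beats `τ = 2.371`»; design in the module docstring of
`AbelianSTPPCensusTALin1200Defs.lean`.  Proofs only:
* the candidate enumeration (`mem_triples`, `of_mem_triples`, `mem_triples_of_cand`, `minOver_le`, `le_minOver`, `cand_bounds`, `pminL_le_us`,
  `three_le_pminL`; verbatim `TAKnap575` at this file's `Mtop`) and the permutation invariance of the table test (`tableOK_swap12/23/13`);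
* the state invariant along the volumes (`inv_st0`, `inv_of_nil`, `inv_upd`: the vM density `gP/pP` and, for each `t ≤ Tmax` with a valid
  entry, the U11-G density `gW/wW` dominate every candidate shape of volume `≤ V`, with positive weights), the order/shape walk
  (`checkAll_sound`) and the volume loop (`loopL_sound`, `seg_sound`).
Continued in `AbelianSTPPCensusTALin1200Sound.lean` (the Grynkiewicz budget, the sorted form of the maximal member, `sum_gain_le`).
WHAT THIS IS NOT: arithmetic about the checker only; no statement about STPP families or `ω`.
-/

set_option linter.dupNamespace false
set_option autoImplicit false

namespace Summit.MatrixMultiplication.MatrixMultiplication.Theorems.TALin1200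

open TECert (tableOK vol us tableOK_iff tableOK_mono)
open ShapeCert (gainOf2371z D)

/-! ## The candidate enumeration (verbatim `TAKnap575` at this file's `Mtop`) -/

/-- Completeness of the candidate enumeration. [bookkeeping] -/
theorem mem_triples {a b c : ℕ} (ha : 1 ≤ a) (hb : 1 ≤ b) (hc : 1 ≤ c) (h : tableOK TALin1200.Mtop a b c = true) :
    (a, b, c) ∈ TALin1200.triples (a * b * c) := by
  have hVa : a * b * c / a = b * c := by
    rw [mul_assoc]; exact Nat.mul_div_cancel_left _ (by omega)
  have hVab : b * c / b = c := Nat.mul_div_cancel_left _ (by omega)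
  have haV : a ≤ a * b * c := by
    calc a = a * 1 * 1 := by ring
      _ ≤ a * b * c := Nat.mul_le_mul (Nat.mul_le_mul le_rfl hb) hc
  have hbV : b ≤ b * c := by
    calc b = b * 1 := by ring
      _ ≤ b * c := Nat.mul_le_mul le_rfl hc
  simp only [triples, List.mem_flatMap, List.mem_range]
  refine ⟨a - 1, by omega, ?_⟩
  rw [Nat.sub_add_cancel ha, if_pos (by rw [mul_assoc]; exact Nat.mul_mod_right _ _), List.mem_filterMap]
  refine ⟨b - 1, ?_, ?_⟩
  · rw [List.mem_range, hVa]; omega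
  · rw [Nat.sub_add_cancel hb, hVa, hVab, if_pos ⟨Nat.mul_mod_right _ _, h⟩]

/-- What the candidate enumeration guarantees about its members. [bookkeeping] -/
theorem of_mem_triples {V : ℕ} {t : ℕ × ℕ × ℕ} (ht : t ∈ TALin1200.triples V) : TALin1200.Cand t ∧ vol t = V := by
  simp only [triples, List.mem_flatMap, List.mem_range] at ht
  obtain ⟨a', _, hx⟩ := ht
  by_cases h1 : V % (a' + 1) = 0
  · rw [if_pos h1, List.mem_filterMap] at hx
    obtain ⟨b', hb', hy⟩ := hx
    rw [List.mem_range] at hb'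
    by_cases h2 : V / (a' + 1) % (b' + 1) = 0 ∧ tableOK Mtop (a' + 1) (b' + 1) (V / (a' + 1) / (b' + 1)) = true
    · rw [if_pos h2] at hy
      simp only [Option.some.injEq] at hy
      subst hy
      have hd1 : (a' + 1) * (V / (a' + 1)) = V := Nat.mul_div_cancel' (Nat.dvd_of_mod_eq_zero h1)
      have hd2 : (b' + 1) * (V / (a' + 1) / (b' + 1)) = V / (a' + 1) :=
        Nat.mul_div_cancel' (Nat.dvd_of_mod_eq_zero h2.1)
      refine ⟨⟨by simp, by simp, ?_, h2.2⟩, ?_⟩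
      · show 1 ≤ V / (a' + 1) / (b' + 1)
        exact Nat.div_pos (by omega) (by omega)
      · show (a' + 1) * (b' + 1) * (V / (a' + 1) / (b' + 1)) = V
        rw [mul_assoc, hd2, hd1]
    · rw [if_neg h2] at hy; exact absurd hy (by simp)
  · rw [if_neg h1] at hx; exact absurd hx (by simp)

/-- A candidate shape is listed under its volume. [bookkeeping] -/
theorem mem_triples_of_cand {t : ℕ × ℕ × ℕ} (h : TALin1200.Cand t) : t ∈ TALin1200.triples (vol t) := by
  obtain ⟨a, b, c⟩ := t
  exact mem_triples h.1 h.2.1 h.2.2.1 h.2.2.2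

/-- `minOver` is below every value of the list. [bookkeeping] -/
theorem minOver_le (f : ℕ × ℕ × ℕ → ℕ) (m₀ : ℕ) : ∀ (ts : List (ℕ × ℕ × ℕ)) (t : ℕ × ℕ × ℕ), t ∈ ts →
    TALin1200.minOver f m₀ ts ≤ f t
  | [], t, ht => absurd ht (by simp)
  | t' :: ts, t, ht => by
    have hrec : minOver f m₀ (t' :: ts) = f t' - (f t' - minOver f m₀ ts) := by simp [minOver]
    rw [hrec]
    rcases List.mem_cons.mp ht with rfl | h
    · omega
    · have := minOver_le f m₀ ts t h; omega

/-- A common lower bound of the values and the default is below `minOver`. [bookkeeping] -/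
theorem le_minOver (f : ℕ × ℕ × ℕ → ℕ) (m₀ L : ℕ) (h₀ : L ≤ m₀) : ∀ ts : List (ℕ × ℕ × ℕ), (∀ t ∈ ts, L ≤ f t) →
    L ≤ TALin1200.minOver f m₀ ts
  | [], _ => by simpa [minOver] using h₀
  | t' :: ts, hts => by
    have hrec : minOver f m₀ (t' :: ts) = f t' - (f t' - minOver f m₀ ts) := by simp [minOver]
    rw [hrec]
    have h1 := hts t' List.mem_cons_self
    have h2 := le_minOver f m₀ L h₀ ts (fun t ht => hts t (List.mem_cons_of_mem _ ht))
    omega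

/-- Candidates have pair-product sum `≥ 3` and positive volume. [bookkeeping] -/
theorem cand_bounds {t : ℕ × ℕ × ℕ} (h : TALin1200.Cand t) : 3 ≤ us t ∧ 1 ≤ vol t := by
  obtain ⟨a, b, c⟩ := t
  obtain ⟨ha, hb, hc, -⟩ := h
  simp only [us, TECert.uu, TECert.vv, TECert.ww, vol] at *
  have h1 : 1 ≤ a * b := Nat.mul_pos ha hb
  have h2 : 1 ≤ b * c := Nat.mul_pos hb hc
  have h3 : 1 ≤ c * a := Nat.mul_pos hc ha
  exact ⟨by omega, Nat.mul_pos h1 hc⟩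

/-- `pmin` of a non-empty volume is `≥ 3` and below the pair-product sum of every candidate of that volume. [bookkeeping] -/
theorem pminL_le_us {x : ℕ × ℕ × ℕ} (hx : TALin1200.Cand x) : TALin1200.pminL (TALin1200.triples (vol x)) ≤ us x :=
  minOver_le us (3 * Mtop) _ x (mem_triples_of_cand hx)

/-- `pmin ≥ 3`. [bookkeeping] -/
theorem three_le_pminL (V : ℕ) : 3 ≤ TALin1200.pminL (TALin1200.triples V) :=
  le_minOver us (3 * Mtop) 3 (by simp [Mtop]) _ fun t ht => (cand_bounds (of_mem_triples ht).1).1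

/-! ## The table test is symmetric in the three sizes -/

/-- swap of the last two sizes -/
theorem tableOK_swap23 {M a b c : ℕ} (h : tableOK M a b c = true) : tableOK M a c b = true := by
  rw [tableOK_iff] at h ⊢
  obtain ⟨h1, h2, h3, h4, h5, h6, h7⟩ := h
  have e : a * c * b = a * b * c := by ring
  refine ⟨by rw [e]; exact h1, by rw [Nat.add_comm c b]; exact h2, by rw [Nat.add_comm b a]; exact h4,
    by rw [Nat.add_comm a c]; exact h3, by rw [e]; exact h5, by rw [e]; exact h7, by rw [e]; exact h6⟩

/-- swap of the first two sizes -/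
theorem tableOK_swap12 {M a b c : ℕ} (h : tableOK M a b c = true) : tableOK M b a c = true := by
  rw [tableOK_iff] at h ⊢
  obtain ⟨h1, h2, h3, h4, h5, h6, h7⟩ := h
  have e : b * a * c = a * b * c := by ring
  refine ⟨by rw [e]; exact h1, by rw [Nat.add_comm a c]; exact h3, by rw [Nat.add_comm c b]; exact h2,
    by rw [Nat.add_comm b a]; exact h4, by rw [e]; exact h6, by rw [e]; exact h5, by rw [e]; exact h7⟩

/-- swap of the outer two sizes -/
theorem tableOK_swap13 {M a b c : ℕ} (h : tableOK M a b c = true) : tableOK M c b a = true :=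
  tableOK_swap23 (tableOK_swap12 (tableOK_swap23 h))

/-! ## The state invariant along the volumes -/

/-- entries of a `mapIdx` image, read with `getD` -/
theorem getD_mapIdx_updWe (V g pm : ℕ) (W : List (ℕ × ℕ × Bool)) (t : ℕ) (ht : t < W.length) :
    (W.mapIdx fun i e => TALin1200.updWe V g pm i e).getD t (0, 1, false) = TALin1200.updWe V g pm t (W.getD t (0, 1, false)) := by
  rw [List.getD_eq_getElem _ _ (by rw [List.length_mapIdx]; exact ht), List.getElem_mapIdx, List.getD_eq_getElem _ _ ht]

/-- The initial state satisfies the invariant at volume `0` (no candidate has volume `0`). [bookkeeping] -/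
theorem inv_st0 : TALin1200.Inv 0 TALin1200.st0 := by
  refine ⟨by simp [st0], fun x hx hv => absurd hv (by have := (cand_bounds hx).2; omega), by simp [st0], ?_⟩
  intro t ht _
  have hlt : t < (List.replicate (Tmax + 1) ((0 : ℕ), (1 : ℕ), true)).length := by simp; omega
  have hget : (st0.2.2).getD t (0, 1, false) = (0, 1, true) := by
    simp only [st0]
    rw [List.getD_eq_getElem _ _ hlt, List.getElem_replicate]
  rw [hget]
  exact ⟨le_rfl, fun x hx hv => absurd hv (by have := (cand_bounds hx).2; omega)⟩

/-- A volume without candidate shapes: the invariant passes from `V − 1` to `V` unchanged. [bookkeeping] -/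
theorem inv_of_nil {V : ℕ} {s : TALin1200.St} (h : TALin1200.triples V = []) (hI : TALin1200.Inv (V - 1) s) :
    TALin1200.Inv V s := by
  have key : ∀ x, Cand x → vol x ≤ V → vol x ≤ V - 1 := by
    intro x hx hv
    rcases Nat.lt_or_ge (vol x) V with hlt | hge
    · omega
    · exfalso
      have hvt : vol x = V := le_antisymm hv hge
      have := mem_triples_of_cand hx
      rw [hvt, h] at this
      simp at this
  obtain ⟨h1, h2, h3, h4⟩ := hI
  refine ⟨h1, fun x hx hv => h2 x hx (key x hx hv), h3, fun t ht hok => ?_⟩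
  obtain ⟨hw, hx⟩ := h4 t ht hok
  exact ⟨hw, fun x hcx hv => hx x hcx (key x hcx hv)⟩

/-- A volume with candidate shapes: folding it into the state carries the invariant from `V − 1` to `V`. [bookkeeping] -/
theorem inv_upd {V : ℕ} {s : TALin1200.St} (hV : 1 ≤ V) (hI : TALin1200.Inv (V - 1) s) :
    TALin1200.Inv V (TALin1200.upd V (gainOf2371z V) (TALin1200.pminL (TALin1200.triples V)) s) := by
  set g := gainOf2371z V with hg
  set pm := pminL (triples V) with hpm
  have hpm3 : 3 ≤ pm := three_le_pminL V
  -- a candidate of volume `≤ V` has volume `≤ V − 1` or exactly `V`, and then `pm ≤ us x`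
  have hsplit : ∀ x, Cand x → vol x ≤ V → vol x ≤ V - 1 ∨ (vol x = V ∧ pm ≤ us x) := by
    intro x hx hv
    rcases Nat.lt_or_ge (vol x) V with hlt | hge
    · exact Or.inl (by omega)
    · have hvt : vol x = V := le_antisymm hv hge
      exact Or.inr ⟨hvt, by rw [hpm, ← hvt]; exact pminL_le_us hx⟩
  obtain ⟨h1, h2, h3, h4⟩ := hI
  refine ⟨?_, ?_, ?_, ?_⟩
  · -- `pP ≥ 1`
    simp only [upd]
    split <;> omega
  · -- vM density dominates
    intro x hx hv
    simp only [upd]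
    rcases hsplit x hx hv with hle | ⟨hvt, hpx⟩
    · have old := h2 x hx hle
      by_cases hc : s.1 * pm < g * s.2.1
      · rw [if_pos hc, if_pos hc]
        -- g(vol x)·pm ≤ g·us x from old·pm and the replacement condition
        have e1 : gainOf2371z (vol x) * pm * s.2.1 ≤ g * us x * s.2.1 := by
          calc gainOf2371z (vol x) * pm * s.2.1 = gainOf2371z (vol x) * s.2.1 * pm := by ring
            _ ≤ s.1 * us x * pm := Nat.mul_le_mul_right _ old
            _ = s.1 * pm * us x := by ring
            _ ≤ g * s.2.1 * us x := Nat.mul_le_mul_right _ hc.le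
            _ = g * us x * s.2.1 := by ring
        exact Nat.le_of_mul_le_mul_right e1 h1
      · rw [if_neg hc, if_neg hc]; exact old
    · rw [hvt]
      by_cases hc : s.1 * pm < g * s.2.1
      · rw [if_pos hc, if_pos hc]; exact Nat.mul_le_mul_left _ hpx
      · rw [if_neg hc, if_neg hc]
        calc g * s.2.1 ≤ s.1 * pm := not_lt.1 hc
          _ ≤ s.1 * us x := Nat.mul_le_mul_left _ hpx
  · simp only [upd, List.length_mapIdx]; exact h3
  · intro t ht hok
    have htl : t < s.2.2.length := by rw [h3]; omega
    have hget : (upd V g pm s).2.2.getD t (0, 1, false) = updWe V g pm t (s.2.2.getD t (0, 1, false)) := by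
      simp only [upd]; exact getD_mapIdx_updWe V g pm s.2.2 t htl
    rw [hget] at hok ⊢
    set e := s.2.2.getD t (0, 1, false) with he
    -- the old entry must be valid, and `t·pm > V`
    have hok0 : e.2.2 = true := by
      by_contra hne
      have : updWe V g pm t e = e := by simp [updWe, hne]
      rw [this] at hok; exact hne hok
    have htpm : ¬ t * pm ≤ V := by
      intro hle
      have : updWe V g pm t e = (e.1, e.2.1, false) := by simp [updWe, hok0, hle]
      rw [this] at hok; exact absurd hok (by simp)
    obtain ⟨hw, hold⟩ := h4 t ht hok0
    by_cases hc : e.1 * (t * pm - V) < g * e.2.1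
    · have hnew : updWe V g pm t e = (g, t * pm - V, true) := by simp [updWe, hok0, htpm, hc]
      rw [hnew]
      dsimp only
      refine ⟨by omega, fun x hx hv => ?_⟩
      rcases hsplit x hx hv with hle | ⟨hvt, hpx⟩
      · obtain ⟨o1, o2⟩ := hold x hx hle
        refine ⟨o1, ?_⟩
        -- g(vol x)·(t pm − V) ≤ g·(t us x − vol x)
        have e1 : gainOf2371z (vol x) * (t * pm - V) * e.2.1 ≤ g * (t * us x - vol x) * e.2.1 := by
          calc gainOf2371z (vol x) * (t * pm - V) * e.2.1 = gainOf2371z (vol x) * e.2.1 * (t * pm - V) := by ring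
            _ ≤ e.1 * (t * us x - vol x) * (t * pm - V) := Nat.mul_le_mul_right _ o2
            _ = e.1 * (t * pm - V) * (t * us x - vol x) := by ring
            _ ≤ g * e.2.1 * (t * us x - vol x) := Nat.mul_le_mul_right _ hc.le
            _ = g * (t * us x - vol x) * e.2.1 := by ring
        exact Nat.le_of_mul_le_mul_right e1 hw
      · have htus : t * pm ≤ t * us x := Nat.mul_le_mul_left _ hpx
        rw [hvt]
        exact ⟨by omega, Nat.mul_le_mul_left _ (by omega)⟩
    · have hnew : updWe V g pm t e = (e.1, e.2.1, true) := by simp [updWe, hok0, htpm, hc]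
      rw [hnew]
      dsimp only
      refine ⟨hw, fun x hx hv => ?_⟩
      rcases hsplit x hx hv with hle | ⟨hvt, hpx⟩
      · exact hold x hx hle
      · have htus : t * pm ≤ t * us x := Nat.mul_le_mul_left _ hpx
        rw [hvt]
        refine ⟨by omega, ?_⟩
        calc g * e.2.1 ≤ e.1 * (t * pm - V) := not_lt.1 hc
          _ ≤ e.1 * (t * us x - V) := Nat.mul_le_mul_left _ (by omega)

/-- Soundness of the order walk: every shape passes at every order of the range. [bookkeeping] -/
theorem checkAll_sound (s : TALin1200.St) (ts : List (ℕ × ℕ × ℕ)) :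
    ∀ (n M : ℕ), TALin1200.checkAll s ts n M = true →
      ∀ M', M ≤ M' → M' < M + n → ∀ x ∈ ts, TALin1200.checkShape s M' x = true
  | 0, M, _, M', h1, h2, _, _ => by omega
  | n + 1, M, h, M', h1, h2, x, hx => by
    have hunf : checkAll s ts (n + 1) M = (ts.all (checkShape s M) && checkAll s ts n (M + 1)) := rfl
    rw [hunf, Bool.and_eq_true] at h
    rcases Nat.eq_or_lt_of_le h1 with rfl | hlt
    · exact List.all_eq_true.1 h.1 x hx
    · exact checkAll_sound s ts n (M + 1) h.2 M' hlt (by omega) x hx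

/-- Soundness of the volume loop: from the invariant at `V − 1`, a `true` first component yields the invariant for the final state at
`V + k − 1` and the checks for every volume of `[V, V + k)`. [bookkeeping] -/
theorem loopL_sound (lo n : ℕ) : ∀ (k V : ℕ) (s : TALin1200.St), 1 ≤ V → TALin1200.Inv (V - 1) s →
    (TALin1200.loopL lo n k V s).1 = true →
      TALin1200.Inv (V + k - 1) (TALin1200.loopL lo n k V s).2 ∧
        ∀ V', V ≤ V' → V' < V + k → TALin1200.Checked lo n V'
  | 0, V, s, _, hInv, _ => ⟨by simpa [loopL] using hInv, fun V' h1 h2 => by omega⟩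
  | k + 1, V, s, hV, hInv, h => by
    cases hT : triples V with
    | nil =>
      have hred : loopL lo n (k + 1) V s = loopL lo n k (V + 1) s := by
        simp [loopL, hT]
      rw [hred] at h ⊢
      have hInv' : Inv (V + 1 - 1) s := by simpa using inv_of_nil hT hInv
      obtain ⟨h1, h2⟩ := loopL_sound lo n k (V + 1) s (by omega) hInv' h
      refine ⟨by simpa [show V + 1 + k - 1 = V + (k + 1) - 1 by omega] using h1, fun V' hV' hlt => ?_⟩
      rcases Nat.eq_or_lt_of_le hV' with rfl | hlt'
      · intro hne; exact absurd hT hne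
      · exact h2 V' hlt' (by omega)
    | cons t ts =>
      set s' := upd V (gainOf2371z V) (pminL (triples V)) s with hs'
      have hred : loopL lo n (k + 1) V s =
          ((Nat.beq (stSum s') (stSum s') && checkAll s' (triples V) n lo) && (loopL lo n k (V + 1) s').1,
            (loopL lo n k (V + 1) s').2) := by
        simp only [loopL, hT, hs']
      rw [hred] at h ⊢
      simp only [Bool.and_eq_true] at h
      obtain ⟨⟨-, hchk⟩, hrec⟩ := h
      have hInv' : Inv V s' := inv_upd hV hInv
      obtain ⟨h1, h2⟩ := loopL_sound lo n k (V + 1) s' (by omega) (by simpa using hInv') hrec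
      refine ⟨by simpa [show V + 1 + k - 1 = V + (k + 1) - 1 by omega] using h1, fun V' hV' hlt => ?_⟩
      rcases Nat.eq_or_lt_of_le hV' with rfl | hlt'
      · intro _
        refine ⟨s', hInv', fun M hM1 hM2 x hx => ?_⟩
        exact checkAll_sound s' (triples V) n lo hchk M hM1 hM2 x hx
      · exact h2 V' hlt' (by omega)

/-- A segment certificate: from the invariant at `V − 1` for `sA`, the kernel fact `loopL lo n k V sA = (true, sB)` yields the invariant at
`V + k − 1` for `sB` and the checks on `[V, V + k)`. [bookkeeping] -/
theorem seg_sound {lo n k V : ℕ} {sA sB : TALin1200.St} (hV : 1 ≤ V) (hA : TALin1200.Inv (V - 1) sA)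
    (h : TALin1200.loopL lo n k V sA = (true, sB)) :
    TALin1200.Inv (V + k - 1) sB ∧ ∀ V', V ≤ V' → V' < V + k → TALin1200.Checked lo n V' := by
  have h1 : (loopL lo n k V sA).1 = true := by rw [h]
  have h2 : (loopL lo n k V sA).2 = sB := by rw [h]
  simpa [h2] using loopL_sound lo n k V sA hV hA h1

end Summit.MatrixMultiplication.MatrixMultiplication.Theorems.TALin1200
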